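import Summits.BirchSwinnertonDyer.BirchSwinnertonDyer.Theorems.QuadraticBranchSignedControlPlusEtaNonsurjConjADoorBSDRankOne
import Summits.BirchSwinnertonDyer.BirchSwinnertonDyer.Theorems.QuadraticBranchSignedControlPlusEtaNonsurjConjADoorFamilyRecords
import Summits.BirchSwinnertonDyer.Rank1Residual.X11b.KrausMinimalityGeneralTwo
import HarnessLib

/-!
# Route `QuadraticBranchSignedControl` (rung K8, cell `bsd-potss`), residual crux `PlusEtaMainConjectureNonsurj`
# (stmt-BirchSwinnertonDyer-19606): FAMILY RECORDS E — `MissingPPartAt W 5` (ord₅ #Ш = ord₅ #Ш_an) on the four door-L4 family rows of records D: c5b:−23 (unit: modulo named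
# facts only) and c5e:37, c5a:−19, c5d:8 (rank one: modulo C-cc-1 AT THE ROW)
# (seat `bsd-potss-k8eta-c2` g22; data k8eta-c2 g21 kits j326606 / j327196, GRH)

WHAT. In g21's family census (65 congruent-class rows) nine rows carried «PASS-L3(S-classes)»; this seat's (c3) check (kit j330635) shows the
killing classes lie above a multiplicative prime `ℓ ∈ {29, 241, 271, 31, 59, 11}` with `W(ℚ_ℓ)[5] ≠ 0` — (c3) FAILS, so the `S`-split door is VOID
there (no theorem licenses it; kernel reason `EtaConjADoorSplit.apply_mk0_eq_zero_of_decomp`, p716503). But five of the nine have g21 Hecke verdict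
TWIST (`T_y = −Tr` on the tautological line: it belongs to `ρ̄ ⊗ ε′`, (c2) for `W` HOLDS) — door L4 passes INDEPENDENTLY of `S`. Here the four rows of records D are carried to the cell's target currency: `missingPPartAt_c5b_m23_5_of_heckeEigenHom` (unit row, p717939's
`EtaConjADoorUnitBSD.missingPPartAt_of_heckeEigenHom_of_isUnit`: named facts `hGZK hmod hnf hM h12 hKO h22 h41 h6273` only) and
`missingPPartAt_r1_{c5e_37, c5a_m19, c5d_8}_5_of_heckeEigenHom` (rank one, p718742's `EtaConjADoorBSDRankOne.bsdp_r1_of_heckeEigenHom`: the same facts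
+ `hGZ h74` + the route's declared residual C-cc-1 AT THE ROW, displayed, NOT certified); kernel: global minimality of each `W`
(`isGloballyMinimal_of_krausCriterion_support`, `decide`); the fifth, c5e:−19, has `r_an = 2` (no record shape). These are CONGRUENT-class
rows (bases `A = [0,0,0,−3135,−40138]` (c5b), `[0,0,0,−104280,−12025372]` (c5e), `[0,0,0,−345,5157]` (c5a), `[0,0,1,−46110,3870549]` (c5d); in-table
partner conductors 78300, 243900, 26100, 162675): covered IN SHAPE by v7's CL25-transfer branch — these records are binder-free.
ERRATUM (docstrings only, statements unaffected): in p716999 / p719462 the base of family c5f is misnamed; the c5f base row curve is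
`A = [0,0,1,−840,362]` (partner conductor 341775), and c5e's is `[0,0,0,−104280,−12025372]` (243900).

HONEST FRAMING (cell `bsd-potss`; FULL-BSD rank ≤ 1 programme, HUMAN RULING D-0036/D-0074): per-row RECORDS, CONDITIONAL on the displayed named
facts (`h22 h41 h6273` [+ `hGZK` on rank one]) and per-row inputs (tower clause, unit certificate resp. `r_an = 1` and `(L_5⁺) = (X)`, the
Hecke-refined eigen datum); GRH numerics are evidence, not facts; no stub of 19606 proved; crux and route OPEN; nothing booked; `BSD(W,5)` claimed for
no pair. `--supports stmt-BirchSwinnertonDyer-19606`.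

References: [Kobayashi2003] Thm. 2.2, §4, Thm. 4.1; [CoatesSujatha2005] §3 (A); [DeoRaySujatha2023] Thm. 3.8–3.9; [Zywina2015] Thm. 1.4.
-/

set_option autoImplicit false
set_option linter.dupNamespace false
noncomputable section

open scoped Classical nonZeroDivisors

open CongruenceSubgroup NumberField Field WeierstrassCurve
open Literature.NumberTheory.EllipticCurves Literature.NumberTheory.EllipticCurves.ModularForms
  Literature.NumberTheory.EllipticCurves.Rank1Residual Literature.NumberTheory.EllipticCurves.Rank1Residual.Typed
  Literature.NumberTheory.GaloisRepresentations Literature.NumberTheory.GaloisCohomology Literature.NumberTheory.NumberFields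
  Literature.NumberTheory.EllipticCurves.GreenbergVatsal2000 ZpExtension
open Summit.BirchSwinnertonDyer.Rank1Residual Summit.BirchSwinnertonDyer.Rank1Residual.Additive
open Summit.BirchSwinnertonDyer.Rank1Residual.X11b (isElliptic_of_discOf_ne_zero)
open Summit.BirchSwinnertonDyer.BirchSwinnertonDyer.Theorems
open Summit.BirchSwinnertonDyer.Rank1Residual.X11b (isGloballyMinimal_of_krausCriterion_support)

namespace Summit.BirchSwinnertonDyer.BirchSwinnertonDyer.Theorems.EtaConjADoorFamilyBSDRecords

set_option maxRecDepth 100000 in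
/-- `W = [0, 0, 0, -41460375, 61044880750]` is a global minimal equation (Silverman VII.1 Rem. 1.1 on the support `|Δ| = 2^8 · 3^5 · 5^6 · 23^6 ·
29^5` — at every prime `q` of the support `q¹² ∤ Δ` or `q⁴ ∤ c₄`, or Kraus's test at `2`; tree `isGloballyMinimal_of_krausCriterion_support`, kernel
`decide`). [cite: SilvermanAEC2009, VII.1 Remark 1.1] [cite: Kraus1989, Prop. 1 and Prop. 2] -/
theorem isGloballyMinimal_c5b_m23 : (⟨0, 0, 0, (-41460375), 61044880750⟩ : WeierstrassCurve ℚ).IsGloballyMinimal :=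
  isGloballyMinimal_of_krausCriterion_support 0 0 0 (-41460375) 61044880750 [(2, 0, 8), (3, 0, 5), (5, 0, 6), (23, 0, 6), (29, 0, 5)]
    (by
      intro t ht
      simp only [List.mem_cons, List.not_mem_nil, or_false] at ht
      rcases ht with rfl | rfl | rfl | rfl | rfl <;> norm_num)
    (by decide +kernel) (by decide +kernel)

/-- **`MissingPPartAt W 5` — `ord_5 #Ш(W) = ord_5 #Ш_an(W)`, the `5`-part of `BSD(W,5)` — for the CONGRUENT-class UNIT partner c5b:-23, granted ONE
good `a_5 = 0` globally minimal model `V` of `W^{(5)}` with non-onto `5`-adic tower** (`W = [0, 0, 0, -41460375, 61044880750]`, non-CM, `N_W =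
41420700`; kit j326606/j327196 (k8eta-c2 g21) (190+804 s, GRH): `ε(W) = +1`, PARI plus-`η` `(λ, μ) = (0, 0)` — `L_5⁺(V,η,T)` is a UNIT of `Λ` —,
`r_an(W) = 0` (`ellanalyticrank`); `h(ℚ(P)) = 60` (`[30,2]`); eigen dimensions `(d₁,d₂,d₃,d₄) = (0,1,0,0)`; Hecke datum (conjA g13 hecke13 engine,
kit j327196): `Tr ρ̄(y) = 3`, `T_y` acts on the tautological line by `c = 2` — verdict TWIST-TYPE (`T_y = −Tr`: the line belongs to `ρ̄ ⊗ ε′`, not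
to `ρ̄`; (c2) for `W` holds) — door L4 (Hecke-refined eigen-test) passes) from the ROW ALONE — named facts `hGZK hmod hnf hM h12 hKO h22 h41 h6273`
(GZK, modularity, newforms, Mazur `p ∤ c₀`, Kobayashi Thm. 1.2 / 2.2 / 4.1 / 6.2–7.3, Kitajima–Otsuki Thm. 1.3; Poitou–Tate and the plus transport
are tree theorems); displayed: `r_an(W) = 0`, the twin `V` with the tower clause, the unit certificate «every `L_5⁺(V,η,T)` is a unit», the
class-group datum. Instance of `EtaConjADoorUnitBSD.missingPPartAt_of_heckeEigenHom_of_isUnit` (k8eta-c2 g22). CONDITIONAL; nothing booked. [cite: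
Kobayashi2003, §4 (p. 8), Thm. 2.2 (p. 5)] [cite: CoatesSujatha2005, §3 (A) and Thm. 3.4] [cite: Zywina2015, Thm. 1.4] -/
theorem missingPPartAt_c5b_m23_5_of_heckeEigenHom
    (hGZK : rank_eq_analyticRank_of_analyticRank_le_one) (hmod : hasEntireLFunction_rat)
    (hnf : exists_isNewformOf) (hM : mazur_not_dvd_maninConstant_of_odd)
    (h12 : Kobayashi2003.thm12_signedSelmerDual_finite_torsion)
    (hKO : KitajimaOtsuki2018.mainThm13_etaSignedSelmerDual_noFiniteSubmodule)
    (h22 : Kobayashi2003.thm22_etaSignedSelmerDual_finite_torsion)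
    (h41 : Kobayashi2003.thm41_plusEtaCharIdeal_dvd)
    (h6273 : Kobayashi2003.thm62_63_73_etaColemanPoitouTate) [Fact (5 : ℕ).Prime]
    (W : WeierstrassCurve ℚ) (hW : W = (⟨0, 0, 0, (-41460375), 61044880750⟩ : WeierstrassCurve ℚ))
    (V : WeierstrassCurve ℚ) [V.IsElliptic] [V.IsGloballyMinimal] (C : VariableChange ℚ)
    (hC : C • W.quadraticTwist 5 = V)
    (hgood : V.HasGoodReductionAtPrime 5) (hap : V.frobeniusTrace 5 = 0)
    (hns : ¬ ∀ m : ℕ, V.HasSurjectiveModNGaloisRep (5 ^ m : ℕ))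
    (hunit : ∀ {N : ℕ} [NeZero N] {f : CuspForm (Gamma0 N) 2}, IsNewformOf V f →
      ∀ (ϖ : ℚ), (if Even (5 / 2) then (ϖ : ℝ) * V.realPeriodRat = plusPeriod f
          else (ϖ : ℝ) * V.imaginaryPeriodRat = minusPeriod f) →
      ∀ (Lη : IwasawaAlgebra 5), IsQuadraticBranchPlusLFunction f 5 ϖ Lη → IsUnit Lη)
    (hP : haveI : W.IsElliptic := hW ▸ Summit.BirchSwinnertonDyer.BirchSwinnertonDyer.Theorems.EtaConjADoorFamilyRecords.isElliptic_c5b_m23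
      haveI : NeZero (5 : ℕ) := ⟨by norm_num⟩
      haveI : NumberField (W.divisionField 5) := NumberField.mk
      ∃ P : geomTorsion W ((5 : ℕ) : ℤ), P ≠ 0 ∧
        ∀ K : IntermediateField ℚ (W.divisionField 5),
          K = IntermediateField.fixedField
            ((MulAction.stabilizer (absoluteGaloisGroup ℚ) P).map (absRestrictNormalHom (W.divisionField 5))) →
        ∀ μ : Additive (ClassGroup (𝓞 K)) →+ ZMod 5,
          (∀ (τ : absoluteGaloisGroup ℚ) (σ : K ≃ₐ[ℚ] K) (a : ℕ),
              (∀ x : K, absRestrictNormalHom (W.divisionField 5) τ (x : W.divisionField 5) =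
                ((σ x : K) : W.divisionField 5)) → τ • P = a • P →
              ∀ (I J : (Ideal (𝓞 K))⁰),
                (J : Ideal (𝓞 K)) = (I : Ideal (𝓞 K)).map (AmbiguousClass.intAut σ : 𝓞 K →+* 𝓞 K) →
                μ (Additive.ofMul (ClassGroup.mk0 J)) = a • μ (Additive.ofMul (ClassGroup.mk0 I))) →
          (∀ (τ τ₁ : absoluteGaloisGroup ℚ) (a a₁ b : ℕ) (Q : geomTorsion W ((5 : ℕ) : ℤ)),
              τ • P = a • P + Q → τ₁ • P = a₁ • P → τ₁ • Q = b • Q → (a₁ : ZMod 5) ≠ (b : ZMod 5) →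
              ∀ I : (Ideal (𝓞 K))⁰,
                μ (Additive.ofMul (classGroupNorm K (W.divisionField 5) (ClassGroup.mulEquiv
                  (AmbiguousClass.intAut (absRestrictNormalHom (W.divisionField 5) τ))
                    (classGroupExtend K (W.divisionField 5) (ClassGroup.mk0 I))))) =
                  (Nat.card ((W.divisionField 5) ≃ₐ[K] (W.divisionField 5)) * a) •
                    μ (Additive.ofMul (ClassGroup.mk0 I))) →
          μ = 0) (hr0 : W.analyticRank = 0) :
    MissingPPartAt W 5 := by
  subst hW
  haveI : (⟨0, 0, 0, (-41460375), 61044880750⟩ : WeierstrassCurve ℚ).IsElliptic := Summit.BirchSwinnertonDyer.BirchSwinnertonDyer.Theorems.EtaConjADoorFamilyRecords.isElliptic_c5b_m23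
  haveI : (⟨0, 0, 0, (-41460375), 61044880750⟩ : WeierstrassCurve ℚ).IsGloballyMinimal := isGloballyMinimal_c5b_m23
  haveI : NeZero (5 : ℕ) := ⟨by norm_num⟩
  exact EtaConjADoorUnitBSD.missingPPartAt_of_heckeEigenHom_of_isUnit _ 5 hGZK hmod hnf hM h12 hKO h22 h41 h6273 (le_refl 5) V C
    (by rw [show ((-1 : ℚ) ^ ((5 : ℕ) / 2) * ((5 : ℕ) : ℚ)) = 5 by norm_num]; exact hC) hgood hap hns hP hunit hr0

set_option maxRecDepth 100000 in
/-- `W = [0, 0, 0, -3568983000, -76140145989500]` is a global minimal equation (Silverman VII.1 Rem. 1.1 on the support `|Δ| = 2^8 · 3^3 · 5^6 ·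
37^6 · 271^5` — at every prime `q` of the support `q¹² ∤ Δ` or `q⁴ ∤ c₄`, or Kraus's test at `2`; tree
`isGloballyMinimal_of_krausCriterion_support`, kernel `decide`). [cite: SilvermanAEC2009, VII.1 Remark 1.1] [cite: Kraus1989, Prop. 1 and Prop. 2]
-/
theorem isGloballyMinimal_c5e_37 : (⟨0, 0, 0, (-3568983000), (-76140145989500)⟩ : WeierstrassCurve ℚ).IsGloballyMinimal :=
  isGloballyMinimal_of_krausCriterion_support 0 0 0 (-3568983000) (-76140145989500) [(2, 0, 8), (3, 0, 3), (5, 0, 6), (37, 0, 6), (271, 0, 5)]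
    (by
      intro t ht
      simp only [List.mem_cons, List.not_mem_nil, or_false] at ht
      rcases ht with rfl | rfl | rfl | rfl | rfl <;> norm_num)
    (by decide +kernel) (by decide +kernel)

/-- **`MissingPPartAt W 5` — `ord_5 #Ш(W) = ord_5 #Ш_an(W)` (from Miller's `BSDp W 5`) — for the CONGRUENT-class prime-`L` rank-one partner c5e:37,
granted ONE good `a_5 = 0` globally minimal model `V` of `W^{(5)}` with non-onto `5`-adic tower AND the route's residual crux C-cc-1 AT THIS ROW**
(`W = [0, 0, 0, -3568983000, -76140145989500]`, non-CM, `N_W = 333899100`; kit j326606/j327196 (k8eta-c2 g21) (209+1072 s, GRH): `ε(W) = −1`, PARI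
plus-`η` `(λ, μ) = (1, 0)`, `r_an(W) = 1` (`k8eta-c2 g19 etanc`); `h(ℚ(P)) = 40` (`[10,2,2]`); eigen dimensions `(d₁,d₂,d₃,d₄) = (0,1,0,0)`; Hecke
datum (conjA g13 hecke13 engine, kit j327196): `Tr ρ̄(y) = 4`, `T_y` acts on the tautological line by `c = 1` — verdict TWIST-TYPE (`T_y = −Tr`: the
line belongs to `ρ̄ ⊗ ε′`, not to `ρ̄`; (c2) for `W` holds) — door L4 (Hecke-refined eigen-test) passes) from the ROW ALONE — named facts `hGZK hmod
hnf hM h12 hKO hGZ h74 h22 h41 h6273` (GZK, modularity, newforms, Mazur `p ∤ c₀`, Kobayashi Thm. 1.2 / 2.2 / 4.1 / 6.2–7.4, Kitajima–Otsuki Thm.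
1.3, Gross–Zagier I (7.3); Poitou–Tate and the layer comparison are tree theorems); displayed: `r_an(W) = 1`, the twin `V` with the tower clause,
`(L_5⁺(V,η,X)) = (X)`, and the route's DECLARED RESIDUAL crux C-cc-1 AT THIS ROW (`QuadraticBranchMinusLeadingValuationAt W 5 0`, the regulator-free
`δ = 0` valuation law — OPEN, not certified here), the class-group datum. Instance of `EtaConjADoorBSDRankOne.bsdp_r1_of_heckeEigenHom` (k8eta-c2
g22). CONDITIONAL; nothing booked. [cite: Kobayashi2003, §4 (p. 8), Thm. 2.2 (p. 5)] [cite: CoatesSujatha2005, §3 (A) and Thm. 3.4] [cite: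
Zywina2015, Thm. 1.4] -/
theorem missingPPartAt_r1_c5e_37_5_of_heckeEigenHom
    (hGZK : rank_eq_analyticRank_of_analyticRank_le_one) (hmod : hasEntireLFunction_rat)
    (hnf : exists_isNewformOf) (hM : mazur_not_dvd_maninConstant_of_odd)
    (h12 : Kobayashi2003.thm12_signedSelmerDual_finite_torsion)
    (hKO : KitajimaOtsuki2018.mainThm13_etaSignedSelmerDual_noFiniteSubmodule)
    (hGZ : GrossZagier1986_thm_I_7_3) (h74 : Kobayashi2003.thm74_etaEvenMC_iff_etaOddMC)
    (h22 : Kobayashi2003.thm22_etaSignedSelmerDual_finite_torsion)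
    (h41 : Kobayashi2003.thm41_plusEtaCharIdeal_dvd)
    (h6273 : Kobayashi2003.thm62_63_73_etaColemanPoitouTate) [Fact (5 : ℕ).Prime]
    (W : WeierstrassCurve ℚ) (hW : W = (⟨0, 0, 0, (-3568983000), (-76140145989500)⟩ : WeierstrassCurve ℚ)) (hr : W.analyticRank = 1)
    (V : WeierstrassCurve ℚ) [V.IsElliptic] [V.IsGloballyMinimal] (C : VariableChange ℚ)
    (hC : C • W.quadraticTwist 5 = V)
    (hgood : V.HasGoodReductionAtPrime 5) (hap : V.frobeniusTrace 5 = 0)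
    (hns : ¬ ∀ m : ℕ, V.HasSurjectiveModNGaloisRep (5 ^ m : ℕ))
    (hX : ∀ {N : ℕ} [NeZero N] {f : CuspForm (Gamma0 N) 2}, IsNewformOf V f →
      ∀ (ϖ : ℚ), (if Even (5 / 2) then (ϖ : ℝ) * V.realPeriodRat = plusPeriod f
          else (ϖ : ℝ) * V.imaginaryPeriodRat = minusPeriod f) →
      ∀ (Lη : IwasawaAlgebra 5), IsQuadraticBranchPlusLFunction f 5 ϖ Lη →
        Ideal.span {Lη} = Ideal.span {(PowerSeries.X : IwasawaAlgebra 5)})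
    (hP : haveI : W.IsElliptic := hW ▸ Summit.BirchSwinnertonDyer.BirchSwinnertonDyer.Theorems.EtaConjADoorFamilyRecords.isElliptic_c5e_37
      haveI : NeZero (5 : ℕ) := ⟨by norm_num⟩
      haveI : NumberField (W.divisionField 5) := NumberField.mk
      ∃ P : geomTorsion W ((5 : ℕ) : ℤ), P ≠ 0 ∧
        ∀ K : IntermediateField ℚ (W.divisionField 5),
          K = IntermediateField.fixedField
            ((MulAction.stabilizer (absoluteGaloisGroup ℚ) P).map (absRestrictNormalHom (W.divisionField 5))) →
        ∀ μ : Additive (ClassGroup (𝓞 K)) →+ ZMod 5,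
          (∀ (τ : absoluteGaloisGroup ℚ) (σ : K ≃ₐ[ℚ] K) (a : ℕ),
              (∀ x : K, absRestrictNormalHom (W.divisionField 5) τ (x : W.divisionField 5) =
                ((σ x : K) : W.divisionField 5)) → τ • P = a • P →
              ∀ (I J : (Ideal (𝓞 K))⁰),
                (J : Ideal (𝓞 K)) = (I : Ideal (𝓞 K)).map (AmbiguousClass.intAut σ : 𝓞 K →+* 𝓞 K) →
                μ (Additive.ofMul (ClassGroup.mk0 J)) = a • μ (Additive.ofMul (ClassGroup.mk0 I))) →
          (∀ (τ τ₁ : absoluteGaloisGroup ℚ) (a a₁ b : ℕ) (Q : geomTorsion W ((5 : ℕ) : ℤ)),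
              τ • P = a • P + Q → τ₁ • P = a₁ • P → τ₁ • Q = b • Q → (a₁ : ZMod 5) ≠ (b : ZMod 5) →
              ∀ I : (Ideal (𝓞 K))⁰,
                μ (Additive.ofMul (classGroupNorm K (W.divisionField 5) (ClassGroup.mulEquiv
                  (AmbiguousClass.intAut (absRestrictNormalHom (W.divisionField 5) τ))
                    (classGroupExtend K (W.divisionField 5) (ClassGroup.mk0 I))))) =
                  (Nat.card ((W.divisionField 5) ≃ₐ[K] (W.divisionField 5)) * a) •
                    μ (Additive.ofMul (ClassGroup.mk0 I))) →
          μ = 0)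
    (hcc1 : haveI : W.IsElliptic := hW ▸ Summit.BirchSwinnertonDyer.BirchSwinnertonDyer.Theorems.EtaConjADoorFamilyRecords.isElliptic_c5e_37
      haveI : W.IsGloballyMinimal := hW ▸ isGloballyMinimal_c5e_37
      QuadraticBranchMinusLeadingValuationAt W 5 0) :
    MissingPPartAt W 5 := by
  subst hW
  haveI : (⟨0, 0, 0, (-3568983000), (-76140145989500)⟩ : WeierstrassCurve ℚ).IsElliptic := Summit.BirchSwinnertonDyer.BirchSwinnertonDyer.Theorems.EtaConjADoorFamilyRecords.isElliptic_c5e_37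
  haveI : (⟨0, 0, 0, (-3568983000), (-76140145989500)⟩ : WeierstrassCurve ℚ).IsGloballyMinimal := isGloballyMinimal_c5e_37
  haveI : NeZero (5 : ℕ) := ⟨by norm_num⟩
  haveI : Finite (⟨0, 0, 0, (-3568983000), (-76140145989500)⟩ : WeierstrassCurve ℚ).sha := (hGZK _ (by omega)).2
  exact missingPPartAt_of_bsdp _ 5 (EtaConjADoorBSDRankOne.bsdp_r1_of_heckeEigenHom _ 5 hGZK hmod hnf hM h12 hKO hGZ h74 h22 h41 h6273 (le_refl 5) hr V C
    (by rw [show ((-1 : ℚ) ^ ((5 : ℕ) / 2) * ((5 : ℕ) : ℚ)) = 5 by norm_num]; exact hC) hgood hap hns hX hP hcc1)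

set_option maxRecDepth 100000 in
/-- `W = [0, 0, 0, -3113625, -4421482875]` is a global minimal equation (Silverman VII.1 Rem. 1.1 on the support `|Δ| = 2^4 · 3^3 · 5^6 · 19^6 ·
29^5` — at every prime `q` of the support `q¹² ∤ Δ` or `q⁴ ∤ c₄`, or Kraus's test at `2`; tree `isGloballyMinimal_of_krausCriterion_support`, kernel
`decide`). [cite: SilvermanAEC2009, VII.1 Remark 1.1] [cite: Kraus1989, Prop. 1 and Prop. 2] -/
theorem isGloballyMinimal_c5a_m19 : (⟨0, 0, 0, (-3113625), (-4421482875)⟩ : WeierstrassCurve ℚ).IsGloballyMinimal :=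
  isGloballyMinimal_of_krausCriterion_support 0 0 0 (-3113625) (-4421482875) [(2, 0, 4), (3, 0, 3), (5, 0, 6), (19, 0, 6), (29, 0, 5)]
    (by
      intro t ht
      simp only [List.mem_cons, List.not_mem_nil, or_false] at ht
      rcases ht with rfl | rfl | rfl | rfl | rfl <;> norm_num)
    (by decide +kernel) (by decide +kernel)

/-- **`MissingPPartAt W 5` — `ord_5 #Ш(W) = ord_5 #Ш_an(W)` (from Miller's `BSDp W 5`) — for the CONGRUENT-class prime-`L` rank-one partner c5a:-19,
granted ONE good `a_5 = 0` globally minimal model `V` of `W^{(5)}` with non-onto `5`-adic tower AND the route's residual crux C-cc-1 AT THIS ROW**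
(`W = [0, 0, 0, -3113625, -4421482875]`, non-CM, `N_W = 9422100`; kit j326606/j327196 (k8eta-c2 g21) (147+623 s, GRH): `ε(W) = −1`, PARI plus-`η`
`(λ, μ) = (1, 0)`, `r_an(W) = 1` (`k8eta-c2 g19 etanc`); `h(ℚ(P)) = 20` (`[10,2]`); eigen dimensions `(d₁,d₂,d₃,d₄) = (0,1,0,0)`; Hecke datum (conjA
g13 hecke13 engine, kit j327196): `Tr ρ̄(y) = 4`, `T_y` acts on the tautological line by `c = 1` — verdict TWIST-TYPE (`T_y = −Tr`: the line belongs
to `ρ̄ ⊗ ε′`, not to `ρ̄`; (c2) for `W` holds) — door L4 (Hecke-refined eigen-test) passes) from the ROW ALONE — named facts `hGZK hmod hnf hM h12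
hKO hGZ h74 h22 h41 h6273` (GZK, modularity, newforms, Mazur `p ∤ c₀`, Kobayashi Thm. 1.2 / 2.2 / 4.1 / 6.2–7.4, Kitajima–Otsuki Thm. 1.3,
Gross–Zagier I (7.3); Poitou–Tate and the layer comparison are tree theorems); displayed: `r_an(W) = 1`, the twin `V` with the tower clause,
`(L_5⁺(V,η,X)) = (X)`, and the route's DECLARED RESIDUAL crux C-cc-1 AT THIS ROW (`QuadraticBranchMinusLeadingValuationAt W 5 0`, the regulator-free
`δ = 0` valuation law — OPEN, not certified here), the class-group datum. Instance of `EtaConjADoorBSDRankOne.bsdp_r1_of_heckeEigenHom` (k8eta-c2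
g22). CONDITIONAL; nothing booked. [cite: Kobayashi2003, §4 (p. 8), Thm. 2.2 (p. 5)] [cite: CoatesSujatha2005, §3 (A) and Thm. 3.4] [cite:
Zywina2015, Thm. 1.4] -/
theorem missingPPartAt_r1_c5a_m19_5_of_heckeEigenHom
    (hGZK : rank_eq_analyticRank_of_analyticRank_le_one) (hmod : hasEntireLFunction_rat)
    (hnf : exists_isNewformOf) (hM : mazur_not_dvd_maninConstant_of_odd)
    (h12 : Kobayashi2003.thm12_signedSelmerDual_finite_torsion)
    (hKO : KitajimaOtsuki2018.mainThm13_etaSignedSelmerDual_noFiniteSubmodule)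
    (hGZ : GrossZagier1986_thm_I_7_3) (h74 : Kobayashi2003.thm74_etaEvenMC_iff_etaOddMC)
    (h22 : Kobayashi2003.thm22_etaSignedSelmerDual_finite_torsion)
    (h41 : Kobayashi2003.thm41_plusEtaCharIdeal_dvd)
    (h6273 : Kobayashi2003.thm62_63_73_etaColemanPoitouTate) [Fact (5 : ℕ).Prime]
    (W : WeierstrassCurve ℚ) (hW : W = (⟨0, 0, 0, (-3113625), (-4421482875)⟩ : WeierstrassCurve ℚ)) (hr : W.analyticRank = 1)
    (V : WeierstrassCurve ℚ) [V.IsElliptic] [V.IsGloballyMinimal] (C : VariableChange ℚ)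
    (hC : C • W.quadraticTwist 5 = V)
    (hgood : V.HasGoodReductionAtPrime 5) (hap : V.frobeniusTrace 5 = 0)
    (hns : ¬ ∀ m : ℕ, V.HasSurjectiveModNGaloisRep (5 ^ m : ℕ))
    (hX : ∀ {N : ℕ} [NeZero N] {f : CuspForm (Gamma0 N) 2}, IsNewformOf V f →
      ∀ (ϖ : ℚ), (if Even (5 / 2) then (ϖ : ℝ) * V.realPeriodRat = plusPeriod f
          else (ϖ : ℝ) * V.imaginaryPeriodRat = minusPeriod f) →
      ∀ (Lη : IwasawaAlgebra 5), IsQuadraticBranchPlusLFunction f 5 ϖ Lη →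
        Ideal.span {Lη} = Ideal.span {(PowerSeries.X : IwasawaAlgebra 5)})
    (hP : haveI : W.IsElliptic := hW ▸ Summit.BirchSwinnertonDyer.BirchSwinnertonDyer.Theorems.EtaConjADoorFamilyRecords.isElliptic_c5a_m19
      haveI : NeZero (5 : ℕ) := ⟨by norm_num⟩
      haveI : NumberField (W.divisionField 5) := NumberField.mk
      ∃ P : geomTorsion W ((5 : ℕ) : ℤ), P ≠ 0 ∧
        ∀ K : IntermediateField ℚ (W.divisionField 5),
          K = IntermediateField.fixedField
            ((MulAction.stabilizer (absoluteGaloisGroup ℚ) P).map (absRestrictNormalHom (W.divisionField 5))) →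
        ∀ μ : Additive (ClassGroup (𝓞 K)) →+ ZMod 5,
          (∀ (τ : absoluteGaloisGroup ℚ) (σ : K ≃ₐ[ℚ] K) (a : ℕ),
              (∀ x : K, absRestrictNormalHom (W.divisionField 5) τ (x : W.divisionField 5) =
                ((σ x : K) : W.divisionField 5)) → τ • P = a • P →
              ∀ (I J : (Ideal (𝓞 K))⁰),
                (J : Ideal (𝓞 K)) = (I : Ideal (𝓞 K)).map (AmbiguousClass.intAut σ : 𝓞 K →+* 𝓞 K) →
                μ (Additive.ofMul (ClassGroup.mk0 J)) = a • μ (Additive.ofMul (ClassGroup.mk0 I))) →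
          (∀ (τ τ₁ : absoluteGaloisGroup ℚ) (a a₁ b : ℕ) (Q : geomTorsion W ((5 : ℕ) : ℤ)),
              τ • P = a • P + Q → τ₁ • P = a₁ • P → τ₁ • Q = b • Q → (a₁ : ZMod 5) ≠ (b : ZMod 5) →
              ∀ I : (Ideal (𝓞 K))⁰,
                μ (Additive.ofMul (classGroupNorm K (W.divisionField 5) (ClassGroup.mulEquiv
                  (AmbiguousClass.intAut (absRestrictNormalHom (W.divisionField 5) τ))
                    (classGroupExtend K (W.divisionField 5) (ClassGroup.mk0 I))))) =
                  (Nat.card ((W.divisionField 5) ≃ₐ[K] (W.divisionField 5)) * a) •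
                    μ (Additive.ofMul (ClassGroup.mk0 I))) →
          μ = 0)
    (hcc1 : haveI : W.IsElliptic := hW ▸ Summit.BirchSwinnertonDyer.BirchSwinnertonDyer.Theorems.EtaConjADoorFamilyRecords.isElliptic_c5a_m19
      haveI : W.IsGloballyMinimal := hW ▸ isGloballyMinimal_c5a_m19
      QuadraticBranchMinusLeadingValuationAt W 5 0) :
    MissingPPartAt W 5 := by
  subst hW
  haveI : (⟨0, 0, 0, (-3113625), (-4421482875)⟩ : WeierstrassCurve ℚ).IsElliptic := Summit.BirchSwinnertonDyer.BirchSwinnertonDyer.Theorems.EtaConjADoorFamilyRecords.isElliptic_c5a_m19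
  haveI : (⟨0, 0, 0, (-3113625), (-4421482875)⟩ : WeierstrassCurve ℚ).IsGloballyMinimal := isGloballyMinimal_c5a_m19
  haveI : NeZero (5 : ℕ) := ⟨by norm_num⟩
  haveI : Finite (⟨0, 0, 0, (-3113625), (-4421482875)⟩ : WeierstrassCurve ℚ).sha := (hGZK _ (by omega)).2
  exact missingPPartAt_of_bsdp _ 5 (EtaConjADoorBSDRankOne.bsdp_r1_of_heckeEigenHom _ 5 hGZK hmod hnf hM h12 hKO hGZ h74 h22 h41 h6273 (le_refl 5) hr V C
    (by rw [show ((-1 : ℚ) ^ ((5 : ℕ) / 2) * ((5 : ℕ) : ℚ)) = 5 by norm_num]; exact hC) hgood hap hns hX hP hcc1)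

set_option maxRecDepth 100000 in
/-- `W = [0, 0, 0, -4611000, 3870549250]` is a global minimal equation (Silverman VII.1 Rem. 1.1 on the support `|Δ| = 2^6 · 3^5 · 5^6 · 241^5` — at
every prime `q` of the support `q¹² ∤ Δ` or `q⁴ ∤ c₄`, or Kraus's test at `2`; tree `isGloballyMinimal_of_krausCriterion_support`, kernel `decide`).
[cite: SilvermanAEC2009, VII.1 Remark 1.1] [cite: Kraus1989, Prop. 1 and Prop. 2] -/
theorem isGloballyMinimal_c5d_8 : (⟨0, 0, 0, (-4611000), 3870549250⟩ : WeierstrassCurve ℚ).IsGloballyMinimal :=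
  isGloballyMinimal_of_krausCriterion_support 0 0 0 (-4611000) 3870549250 [(2, 0, 6), (3, 0, 5), (5, 0, 6), (241, 0, 5)]
    (by
      intro t ht
      simp only [List.mem_cons, List.not_mem_nil, or_false] at ht
      rcases ht with rfl | rfl | rfl | rfl <;> norm_num)
    (by decide +kernel) (by decide +kernel)

/-- **`MissingPPartAt W 5` — `ord_5 #Ш(W) = ord_5 #Ш_an(W)` (from Miller's `BSDp W 5`) — for the CONGRUENT-class prime-`L` rank-one partner c5d:8,
granted ONE good `a_5 = 0` globally minimal model `V` of `W^{(5)}` with non-onto `5`-adic tower AND the route's residual crux C-cc-1 AT THIS ROW**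
(`W = [0, 0, 0, -4611000, 3870549250]`, non-CM, `N_W = 10411200`; kit j326606/j327196 (k8eta-c2 g21) (16+165 s, GRH): `ε(W) = −1`, PARI plus-`η`
`(λ, μ) = (1, 0)`, `r_an(W) = 1` (`k8eta-c2 g19 etanc`); `h(ℚ(P)) = 20` (`[10,2]`); eigen dimensions `(d₁,d₂,d₃,d₄) = (0,1,0,0)`; Hecke datum (conjA
g13 hecke13 engine, kit j327196): `Tr ρ̄(y) = 4`, `T_y` acts on the tautological line by `c = 1` — verdict TWIST-TYPE (`T_y = −Tr`: the line belongs
to `ρ̄ ⊗ ε′`, not to `ρ̄`; (c2) for `W` holds) — door L4 (Hecke-refined eigen-test) passes) from the ROW ALONE — named facts `hGZK hmod hnf hM h12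
hKO hGZ h74 h22 h41 h6273` (GZK, modularity, newforms, Mazur `p ∤ c₀`, Kobayashi Thm. 1.2 / 2.2 / 4.1 / 6.2–7.4, Kitajima–Otsuki Thm. 1.3,
Gross–Zagier I (7.3); Poitou–Tate and the layer comparison are tree theorems); displayed: `r_an(W) = 1`, the twin `V` with the tower clause,
`(L_5⁺(V,η,X)) = (X)`, and the route's DECLARED RESIDUAL crux C-cc-1 AT THIS ROW (`QuadraticBranchMinusLeadingValuationAt W 5 0`, the regulator-free
`δ = 0` valuation law — OPEN, not certified here), the class-group datum. Instance of `EtaConjADoorBSDRankOne.bsdp_r1_of_heckeEigenHom` (k8eta-c2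
g22). CONDITIONAL; nothing booked. [cite: Kobayashi2003, §4 (p. 8), Thm. 2.2 (p. 5)] [cite: CoatesSujatha2005, §3 (A) and Thm. 3.4] [cite:
Zywina2015, Thm. 1.4] -/
theorem missingPPartAt_r1_c5d_8_5_of_heckeEigenHom
    (hGZK : rank_eq_analyticRank_of_analyticRank_le_one) (hmod : hasEntireLFunction_rat)
    (hnf : exists_isNewformOf) (hM : mazur_not_dvd_maninConstant_of_odd)
    (h12 : Kobayashi2003.thm12_signedSelmerDual_finite_torsion)
    (hKO : KitajimaOtsuki2018.mainThm13_etaSignedSelmerDual_noFiniteSubmodule)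
    (hGZ : GrossZagier1986_thm_I_7_3) (h74 : Kobayashi2003.thm74_etaEvenMC_iff_etaOddMC)
    (h22 : Kobayashi2003.thm22_etaSignedSelmerDual_finite_torsion)
    (h41 : Kobayashi2003.thm41_plusEtaCharIdeal_dvd)
    (h6273 : Kobayashi2003.thm62_63_73_etaColemanPoitouTate) [Fact (5 : ℕ).Prime]
    (W : WeierstrassCurve ℚ) (hW : W = (⟨0, 0, 0, (-4611000), 3870549250⟩ : WeierstrassCurve ℚ)) (hr : W.analyticRank = 1)
    (V : WeierstrassCurve ℚ) [V.IsElliptic] [V.IsGloballyMinimal] (C : VariableChange ℚ)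
    (hC : C • W.quadraticTwist 5 = V)
    (hgood : V.HasGoodReductionAtPrime 5) (hap : V.frobeniusTrace 5 = 0)
    (hns : ¬ ∀ m : ℕ, V.HasSurjectiveModNGaloisRep (5 ^ m : ℕ))
    (hX : ∀ {N : ℕ} [NeZero N] {f : CuspForm (Gamma0 N) 2}, IsNewformOf V f →
      ∀ (ϖ : ℚ), (if Even (5 / 2) then (ϖ : ℝ) * V.realPeriodRat = plusPeriod f
          else (ϖ : ℝ) * V.imaginaryPeriodRat = minusPeriod f) →
      ∀ (Lη : IwasawaAlgebra 5), IsQuadraticBranchPlusLFunction f 5 ϖ Lη →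
        Ideal.span {Lη} = Ideal.span {(PowerSeries.X : IwasawaAlgebra 5)})
    (hP : haveI : W.IsElliptic := hW ▸ Summit.BirchSwinnertonDyer.BirchSwinnertonDyer.Theorems.EtaConjADoorFamilyRecords.isElliptic_c5d_8
      haveI : NeZero (5 : ℕ) := ⟨by norm_num⟩
      haveI : NumberField (W.divisionField 5) := NumberField.mk
      ∃ P : geomTorsion W ((5 : ℕ) : ℤ), P ≠ 0 ∧
        ∀ K : IntermediateField ℚ (W.divisionField 5),
          K = IntermediateField.fixedField
            ((MulAction.stabilizer (absoluteGaloisGroup ℚ) P).map (absRestrictNormalHom (W.divisionField 5))) →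
        ∀ μ : Additive (ClassGroup (𝓞 K)) →+ ZMod 5,
          (∀ (τ : absoluteGaloisGroup ℚ) (σ : K ≃ₐ[ℚ] K) (a : ℕ),
              (∀ x : K, absRestrictNormalHom (W.divisionField 5) τ (x : W.divisionField 5) =
                ((σ x : K) : W.divisionField 5)) → τ • P = a • P →
              ∀ (I J : (Ideal (𝓞 K))⁰),
                (J : Ideal (𝓞 K)) = (I : Ideal (𝓞 K)).map (AmbiguousClass.intAut σ : 𝓞 K →+* 𝓞 K) →
                μ (Additive.ofMul (ClassGroup.mk0 J)) = a • μ (Additive.ofMul (ClassGroup.mk0 I))) →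
          (∀ (τ τ₁ : absoluteGaloisGroup ℚ) (a a₁ b : ℕ) (Q : geomTorsion W ((5 : ℕ) : ℤ)),
              τ • P = a • P + Q → τ₁ • P = a₁ • P → τ₁ • Q = b • Q → (a₁ : ZMod 5) ≠ (b : ZMod 5) →
              ∀ I : (Ideal (𝓞 K))⁰,
                μ (Additive.ofMul (classGroupNorm K (W.divisionField 5) (ClassGroup.mulEquiv
                  (AmbiguousClass.intAut (absRestrictNormalHom (W.divisionField 5) τ))
                    (classGroupExtend K (W.divisionField 5) (ClassGroup.mk0 I))))) =
                  (Nat.card ((W.divisionField 5) ≃ₐ[K] (W.divisionField 5)) * a) •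
                    μ (Additive.ofMul (ClassGroup.mk0 I))) →
          μ = 0)
    (hcc1 : haveI : W.IsElliptic := hW ▸ Summit.BirchSwinnertonDyer.BirchSwinnertonDyer.Theorems.EtaConjADoorFamilyRecords.isElliptic_c5d_8
      haveI : W.IsGloballyMinimal := hW ▸ isGloballyMinimal_c5d_8
      QuadraticBranchMinusLeadingValuationAt W 5 0) :
    MissingPPartAt W 5 := by
  subst hW
  haveI : (⟨0, 0, 0, (-4611000), 3870549250⟩ : WeierstrassCurve ℚ).IsElliptic := Summit.BirchSwinnertonDyer.BirchSwinnertonDyer.Theorems.EtaConjADoorFamilyRecords.isElliptic_c5d_8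
  haveI : (⟨0, 0, 0, (-4611000), 3870549250⟩ : WeierstrassCurve ℚ).IsGloballyMinimal := isGloballyMinimal_c5d_8
  haveI : NeZero (5 : ℕ) := ⟨by norm_num⟩
  haveI : Finite (⟨0, 0, 0, (-4611000), 3870549250⟩ : WeierstrassCurve ℚ).sha := (hGZK _ (by omega)).2
  exact missingPPartAt_of_bsdp _ 5 (EtaConjADoorBSDRankOne.bsdp_r1_of_heckeEigenHom _ 5 hGZK hmod hnf hM h12 hKO hGZ h74 h22 h41 h6273 (le_refl 5) hr V C
    (by rw [show ((-1 : ℚ) ^ ((5 : ℕ) / 2) * ((5 : ℕ) : ℚ)) = 5 by norm_num]; exact hC) hgood hap hns hX hP hcc1)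

end Summit.BirchSwinnertonDyer.BirchSwinnertonDyer.Theorems.EtaConjADoorFamilyBSDRecords

end
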